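import Mathlib
import Summits.NavierStokesRegularity.NavierStokesRegularity.Theorems.TaoLadderRungTwoBreakOneShiftWindowResSlopeD
import HarnessLib

/-!
# The one-shift window system, XLIII: SQUARE-ROOT-FREE RANGE CERTIFICATES for the renormalisation factor
# `g = (Σ_i z_{i,1}²)^{-1/2}` (`gfac`) and the rsqrt slope `γ = rsqrtDeriv θ = −1/(2 √θ θ)` over an energy range
# `[eLo, eHi]`, `eLo > 0`: Boolean tests in dyadic arithmetic (squares and cubes only) implying `g ∈ G`, `γ ∈ Γ` —
# the fields `hg`, `hγ` of part XLI's `ResSlopeD.Matches`; plus the interval energy of the shell-1 hull (cell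
# harvest/h2-tao-ladder, seat p2; rung1/KERNEL-CHEAP-REPLAY-SPEC.md §6 (i) (g ∈ [gLo,gHi], γ = rsqrtDeriv θ, θ ∈ [eLo,eHi]),
# §8; support for K1(1) = `NoSurvivingDSSOne`, stmt-NavierStokesRegularity-20205)

MODEL lattice ODEs only; nothing here is a statement about the Navier–Stokes equations; no item is closed.

* `gCert eLo eHi G` = `0 ≤ G.lo ∧ G.lo²·eHi ≤ 1 ∧ 0 ≤ G.hi ∧ 1 ≤ G.hi²·eLo`; **`mem_rsqrt_of_gCert`**: `0 < eLo ≤ E ≤ eHi`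
  ⇒ `(√E)⁻¹ ∈ G` (so `gfac z ∈ G` when the shell-1 energy of `z` is in `[eLo, eHi]`);
* `gamCert eLo eHi Γ` = `Γ.lo ≤ 0 ∧ 1 ≤ 4 Γ.lo² eLo³ ∧ Γ.hi ≤ 0 ∧ 4 Γ.hi² eHi³ ≤ 1`; **`mem_rsqrtDeriv_of_gamCert`**:
  `0 < eLo ≤ θ ≤ eHi` ⇒ `rsqrtDeriv θ ∈ Γ`;
* `energyBox d` — `Σ_i sqr (Zb[idx1 i])` and `mem_energyBox` (the shell-1 energy of any `z` in the hull).
-/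

-- the sub-problem namespace repeats the summit name by design (D-0017)
set_option linter.dupNamespace false

namespace Summit.NavierStokesRegularity.NavierStokesRegularity.Theorems

namespace DSSOneShift

open Set Finset
open Summit.NavierStokesRegularity.NavierStokesRegularity.Theorems.TaylorModelCert
open Summit.NavierStokesRegularity.NavierStokesRegularity.Theorems.CertificateGlueOn

/-! ### The renormalisation factor `(√E)⁻¹` -/

/-- TEST for `(√E)⁻¹ ∈ G` on `E ∈ [eLo, eHi]`. [folklore] -/
def gCert (eLo eHi : Dyad) (G : IntervalD) : Bool :=
  Dyad.ble (Dyad.ofInt 0) G.lo && Dyad.ble ((G.lo.mul G.lo).mul eHi) (Dyad.ofInt 1) &&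
    Dyad.ble (Dyad.ofInt 0) G.hi && Dyad.ble (Dyad.ofInt 1) ((G.hi.mul G.hi).mul eLo)

/-- **`(√E)⁻¹ ∈ G` from the square test.** [folklore] -/
theorem mem_rsqrt_of_gCert {eLo eHi : Dyad} {G : IntervalD} (h : gCert eLo eHi G = true) (heLo : 0 < eLo.toReal)
    {E : ℝ} (hE : eLo.toReal ≤ E ∧ E ≤ eHi.toReal) : IntervalD.mem (Real.sqrt E)⁻¹ G := by
  unfold gCert at h
  simp only [Bool.and_eq_true] at h
  obtain ⟨⟨⟨h0, h1⟩, h2⟩, h3⟩ := h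
  have hg0 : 0 ≤ G.lo.toReal := by simpa using (Dyad.ble_iff _ _).1 h0
  have hlo : G.lo.toReal * G.lo.toReal * eHi.toReal ≤ 1 := by simpa using (Dyad.ble_iff _ _).1 h1
  have hh0 : 0 ≤ G.hi.toReal := by simpa using (Dyad.ble_iff _ _).1 h2
  have hhi : 1 ≤ G.hi.toReal * G.hi.toReal * eLo.toReal := by simpa using (Dyad.ble_iff _ _).1 h3
  have hEpos : 0 < E := heLo.trans_le hE.1
  set s := Real.sqrt E with hsdef
  have hs : 0 < s := Real.sqrt_pos.2 hEpos
  have hsq : s * s = E := Real.mul_self_sqrt hEpos.le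
  -- lower: G.lo · s ≤ 1
  have hl2 : (G.lo.toReal * s) * (G.lo.toReal * s) ≤ 1 := by
    have : (G.lo.toReal * s) * (G.lo.toReal * s) = G.lo.toReal * G.lo.toReal * E := by rw [← hsq]; ring
    rw [this]
    have hEh : G.lo.toReal * G.lo.toReal * E ≤ G.lo.toReal * G.lo.toReal * eHi.toReal :=
      mul_le_mul_of_nonneg_left hE.2 (mul_nonneg hg0 hg0)
    exact hEh.trans hlo
  have hl1 : G.lo.toReal * s ≤ 1 := by nlinarith [mul_nonneg hg0 hs.le]
  -- upper: 1 ≤ G.hi · s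
  have hu2 : 1 ≤ (G.hi.toReal * s) * (G.hi.toReal * s) := by
    have : (G.hi.toReal * s) * (G.hi.toReal * s) = G.hi.toReal * G.hi.toReal * E := by rw [← hsq]; ring
    rw [this]
    have hEl : G.hi.toReal * G.hi.toReal * eLo.toReal ≤ G.hi.toReal * G.hi.toReal * E :=
      mul_le_mul_of_nonneg_left hE.1 (mul_nonneg hh0 hh0)
    exact hhi.trans hEl
  have hu1 : 1 ≤ G.hi.toReal * s := by nlinarith [mul_nonneg hh0 hs.le]
  constructor
  · calc G.lo.toReal = (G.lo.toReal * s) * s⁻¹ := by field_simp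
      _ ≤ 1 * s⁻¹ := mul_le_mul_of_nonneg_right hl1 (inv_nonneg.2 hs.le)
      _ = s⁻¹ := one_mul _
  · calc s⁻¹ = 1 * s⁻¹ := (one_mul _).symm
      _ ≤ (G.hi.toReal * s) * s⁻¹ := mul_le_mul_of_nonneg_right hu1 (inv_nonneg.2 hs.le)
      _ = G.hi.toReal := by field_simp

/-! ### The rsqrt slope `rsqrtDeriv θ = −1 / (2 √θ θ)` -/

/-- TEST for `rsqrtDeriv θ ∈ Γ` on `θ ∈ [eLo, eHi]` (with `Γ ≤ 0`). [folklore] -/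
def gamCert (eLo eHi : Dyad) (Γ : IntervalD) : Bool :=
  Dyad.ble Γ.lo (Dyad.ofInt 0) &&
    Dyad.ble (Dyad.ofInt 1) ((Dyad.ofInt 4).mul ((Γ.lo.mul Γ.lo).mul ((eLo.mul eLo).mul eLo))) &&
    Dyad.ble Γ.hi (Dyad.ofInt 0) &&
    Dyad.ble ((Dyad.ofInt 4).mul ((Γ.hi.mul Γ.hi).mul ((eHi.mul eHi).mul eHi))) (Dyad.ofInt 1)

/-- **`rsqrtDeriv θ ∈ Γ` from the cube test.** [folklore] -/
theorem mem_rsqrtDeriv_of_gamCert {eLo eHi : Dyad} {Γ : IntervalD} (h : gamCert eLo eHi Γ = true)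
    (heLo : 0 < eLo.toReal) {θ : ℝ} (hθ : eLo.toReal ≤ θ ∧ θ ≤ eHi.toReal) : IntervalD.mem (rsqrtDeriv θ) Γ := by
  unfold gamCert at h
  simp only [Bool.and_eq_true] at h
  obtain ⟨⟨⟨h0, h1⟩, h2⟩, h3⟩ := h
  have hl0 : Γ.lo.toReal ≤ 0 := by simpa using (Dyad.ble_iff _ _).1 h0
  have hl1 : 1 ≤ 4 * (Γ.lo.toReal * Γ.lo.toReal * (eLo.toReal * eLo.toReal * eLo.toReal)) := by
    have := (Dyad.ble_iff _ _).1 h1; simp at this; linarith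
  have hh0 : Γ.hi.toReal ≤ 0 := by simpa using (Dyad.ble_iff _ _).1 h2
  have hh1 : 4 * (Γ.hi.toReal * Γ.hi.toReal * (eHi.toReal * eHi.toReal * eHi.toReal)) ≤ 1 := by
    have := (Dyad.ble_iff _ _).1 h3; simp at this; linarith
  have hθpos : 0 < θ := heLo.trans_le hθ.1
  set s := Real.sqrt θ with hsdef
  have hs : 0 < s := Real.sqrt_pos.2 hθpos
  have hsq : s ^ 2 = θ := Real.sq_sqrt hθpos.le
  have hval : rsqrtDeriv θ = -(1 / (2 * s * θ)) := by
    unfold rsqrtDeriv; rw [← hsdef, hsq]; field_simp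
  set w := 2 * s * θ with hwdef
  have hw : 0 < w := by positivity
  have hw2 : w * w = 4 * θ ^ 3 := by
    rw [hwdef]; have : s * s = θ := by rw [← sq]; exact hsq
    nlinarith [this]
  rw [hval]
  -- cube monotonicity
  have hc1 : eLo.toReal * eLo.toReal * eLo.toReal ≤ θ ^ 3 := by
    have h3 : eLo.toReal ^ 3 ≤ θ ^ 3 := pow_le_pow_left₀ heLo.le hθ.1 3
    nlinarith [h3]
  have hc2 : θ ^ 3 ≤ eHi.toReal * eHi.toReal * eHi.toReal := by
    have h3 : θ ^ 3 ≤ eHi.toReal ^ 3 := pow_le_pow_left₀ hθpos.le hθ.2 3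
    nlinarith [h3]
  constructor
  · -- Γ.lo ≤ -(1/w)  ⟸  1 ≤ (-Γ.lo) w
    have hsq1 : 1 ≤ ((-Γ.lo.toReal) * w) * ((-Γ.lo.toReal) * w) := by
      have : ((-Γ.lo.toReal) * w) * ((-Γ.lo.toReal) * w) = 4 * (Γ.lo.toReal * Γ.lo.toReal * θ ^ 3) := by
        rw [show ((-Γ.lo.toReal) * w) * ((-Γ.lo.toReal) * w) = Γ.lo.toReal * Γ.lo.toReal * (w * w) by ring, hw2]; ring
      rw [this]
      nlinarith [mul_nonneg (mul_self_nonneg Γ.lo.toReal) (sub_nonneg.2 hc1)]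
    have h1 : 1 ≤ (-Γ.lo.toReal) * w := by nlinarith [mul_nonneg (neg_nonneg.2 hl0) hw.le]
    have : 1 / w ≤ -Γ.lo.toReal := by rw [div_le_iff₀ hw]; linarith
    linarith
  · -- -(1/w) ≤ Γ.hi  ⟸  (-Γ.hi) w ≤ 1
    have hsq1 : ((-Γ.hi.toReal) * w) * ((-Γ.hi.toReal) * w) ≤ 1 := by
      have : ((-Γ.hi.toReal) * w) * ((-Γ.hi.toReal) * w) = 4 * (Γ.hi.toReal * Γ.hi.toReal * θ ^ 3) := by
        rw [show ((-Γ.hi.toReal) * w) * ((-Γ.hi.toReal) * w) = Γ.hi.toReal * Γ.hi.toReal * (w * w) by ring, hw2]; ring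
      rw [this]
      nlinarith [mul_nonneg (mul_self_nonneg Γ.hi.toReal) (sub_nonneg.2 hc2)]
    have h1 : (-Γ.hi.toReal) * w ≤ 1 := by nlinarith [mul_nonneg (neg_nonneg.2 hh0) hw.le]
    have : -Γ.hi.toReal ≤ 1 / w := by rw [le_div_iff₀ hw]; linarith
    linarith

/-! ### The shell-1 energy of the hull -/

namespace ResSlopeD

variable (d : ResSlopeD)

/-- The interval `Σ_i sqr (Zb[idx1 i])` (shell-1 energy over the hull). [folklore] -/
def energyBox : IntervalD :=
  IntervalD.rangeSumR d.prec (fun i => IntervalD.sqrR d.prec (IntervalD.aget d.Zb (natget d.idx1 i))) d.nm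

variable {m : ℕ} {F : OneShiftFrame m} {e : Fin m × Fin F.W ≃ Fin d.n}
variable {hW1 : 1 < F.W} {hD : F.D < F.W} {g γ : ℝ} {z z' φ : Fin m → ℤ → ℝ}
  {Umat : Matrix (Fin m × Fin F.W) (Fin m × Fin F.W) ℝ} {ρ Ttop : Fin m → ℝ}

/-- **The shell-1 energy of the run lies in `energyBox`.** [folklore] -/
theorem mem_energyBox (M : d.Matches F e hW1 hD g γ z z' φ Umat ρ Ttop) :
    IntervalD.mem (∑ i, z i 1 ^ 2) d.energyBox := by
  unfold energyBox
  rw [M.hm]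
  refine mem_sum_equiv (Equiv.refl (Fin m)) d.prec fun k hk => ?_
  simp only [Equiv.refl_symm, Equiv.refl_apply]
  have h1 := M.hidx1 ⟨k, hk⟩
  simp only at h1
  rw [h1]
  have hz := M.hz ⟨k, hk⟩ ⟨1, hW1⟩
  simp only [Nat.cast_one] at hz
  exact IntervalD.mem_sqrR d.prec hz

end ResSlopeD

end DSSOneShift

end Summit.NavierStokesRegularity.NavierStokesRegularity.Theorems
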